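import Mathlib
import HarnessLib
import Summits.ValiantsHypothesis.ValiantsHypothesis.Theses.MonotoneRestoration
import Literature.Computability.AlgebraicComplexity.ArithCircuit
import Literature.Computability.AlgebraicComplexity.ArithCircuitProofs
import Literature.Computability.AlgebraicComplexity.MonotoneStructure
import Literature.Computability.AlgebraicComplexity.PermanentIrreducible
import Literature.ModelTheory.FiniteModelTheory.CkEquiv
import Summits.ValiantsHypothesis.ValiantsHypothesis.Theorems.MonotoneRestorationMonotoneRestorationQPCosetCount
import Summits.ValiantsHypothesis.ValiantsHypothesis.Theorems.MonotoneRestorationMonotoneRestorationQPSymmetricLB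
import Summits.ValiantsHypothesis.ValiantsHypothesis.Theorems.MonotoneRestorationMonotoneRestorationQPSupportSymmetrisation
import Summits.ValiantsHypothesis.ValiantsHypothesis.Theorems.MonotoneRestorationMonotoneRestorationQPSparseRegime
import Summits.ValiantsHypothesis.ValiantsHypothesis.Theorems.MonotoneRestorationMonotoneRestorationQPBeta
import Literature.Computability.AlgebraicComplexity.SymmetricArithCircuit
import Literature.Computability.AlgebraicComplexity.DawarWilsenach2025Proofs
import Literature.GroupTheory.PermutationGroups.SmallIndexSubgroups
import Summits.ValiantsHypothesis.ValiantsHypothesis.Theorems.MonotoneRestorationQP.Negative.LoadBearing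
import Summits.ValiantsHypothesis.ValiantsHypothesis.Theorems.MonotoneRestorationMonotoneRestorationQPPermSupportCount

/-! TTRL-lite variant V19013 of stmt-ValiantsHypothesis-15886

Variant V19013 (`lemma_proposal`, glue step) of the stub `stub_monotoneComputation_of_complexity`
of line c2 of the crux `MonotoneRestorationQP`: the circuit-level plainification statement
("every fan-in-two circuit `P` over `ℝ≥0` has a plain fan-in-two circuit `Q` with the same
output, `Q.eval = P.eval`, and `Q.size ≤ 3 · P.size`") implies the stub
(every `f` has a Jerrum–Snir monotone computation of size `≤ 3 · complexity f`), via attainment of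
`complexity` (`ArithCircuit.exists_computes_size_eq_complexity`).
-/

-- `ValiantsHypothesis.ValiantsHypothesis`: the D-0017 layout repeats the problem name in the path.
set_option linter.dupNamespace false

namespace Summit.ValiantsHypothesis.ValiantsHypothesis.Theorems

open Summit.ValiantsHypothesis.ValiantsHypothesis.Theses.MonotoneRestoration
open Literature.Computability.AlgebraicComplexity

/-- **TTRL-lite variant V19013** (glue step) of `stub_monotoneComputation_of_complexity`
(stmt-ValiantsHypothesis-15886): if every fan-in-two circuit `P` over `ℝ≥0` can be replaced by a
plain fan-in-two circuit `Q` (all sum coefficients `1`) with `Q.eval = P.eval` and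
`Q.size ≤ 3 · P.size`, then every `f : MvPolynomial σ ℝ≥0` has a Jerrum–Snir monotone computation of
size at most `3 · complexity f` — apply the hypothesis to a size-optimal fan-in-two circuit for `f`
(`ArithCircuit.exists_computes_size_eq_complexity`). [cite: JerrumSnir1982, §2.2] -/
theorem stub_monotoneComputation_of_complexity_var19013 :
    (∀ (σ : Type) (P : ArithCircuit NNReal σ), P.IsFanInTwo →
        ∃ Q : ArithCircuit NNReal σ, Q.IsFanInTwo ∧
          Literature.Barriers.ValiantsHypothesis.IsPlain Q ∧ Q.eval = P.eval ∧ Q.size ≤ 3 * P.size) →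
      ∀ (σ : Type) (f : MvPolynomial σ NNReal), ∃ P : ArithCircuit NNReal σ,
        Literature.Barriers.ValiantsHypothesis.IsMonotoneComputation P f ∧
          P.size ≤ 3 * complexity f := by
  intro hplain σ f
  obtain ⟨P, hP2, hPf, hPs⟩ := ArithCircuit.exists_computes_size_eq_complexity f
  obtain ⟨Q, hQ2, hQplain, hQeval, hQs⟩ := hplain σ P hP2
  refine ⟨Q, ⟨hQ2, hQplain, ?_⟩, ?_⟩
  · show Q.eval = f
    rw [hQeval]
    exact hPf
  · calc Q.size ≤ 3 * P.size := hQs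
      _ = 3 * complexity f := by rw [hPs]

end Summit.ValiantsHypothesis.ValiantsHypothesis.Theorems
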